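import Literature.Analysis.FluidPDE.CarlemanDensity
import Literature.Analysis.FluidPDE.ParabolicCutoffProfile
import Literature.Analysis.FluidPDE.UniqueContinuationCutoff
import Literature.Analysis.FluidPDE.UniqueContinuationRescale
import HarnessLib

/-!
# Unique continuation across spatial boundaries, III: the Carleman estimate of Lemma A.1

Analysis/FluidPDE proof file (theorems only) on the discharge path of the named fact
`Literature.Analysis.FluidPDE.ess_unique_continuation` (`NSLerayHopfProofs.lean`;
Escauriaza–Seregin–Šverák 2003, Thm. 4.1 = Seregin 2014, App. A.2, Thm. 2.4 / Lemma A.1).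
We carry out the core of the proof of Lemma A.1 (Seregin 2014, pp. 210–212,
(A.2.7)–(A.2.17)) in the rescaled variables: for a function `v` of class `C²` near the
cylinder `]0, 7/4] × B̄(0, ρ)` (time first) satisfying there the backward heat inequality
`|∂ₛv + Δv| ≤ δ(|v| + |∇v|)` with a *small* constant `δ` ((A.2.5), (A.2.9)), the bounds
`|v| ≤ A`, `|∇v|² ≤ A²`, and vanishing to infinite order at the origin ((A.2.6)), the first
Carleman inequality (Seregin 2014, Prop. 1.2, proved in the tree:
`Carleman.carleman_inequality_first_of_contDiff_two`) applied to the cut-off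
`w_ε = η_{ρ,ε} v` (`UniqueContinuationCutoff.lean`) yields, after absorbing the `δ`-terms and
letting `ε → 0`,
`∫_{]1/2,1[ × B(y₀,1)} |v|² ≤ K A² e^{-βρ²/4}` for `|y₀| ≤ √(2β) ρ/2`
((A.2.15)–(A.2.17): `D ≤ c A² e^{-βρ²}`, `∫_{Q̃} |v|² ≤ c A² e^{(μ²/2 - 2β)…}`), with constants
`β, δ₀, ρ₀, K` depending only on `E`:

* `carleman_step` — the estimate for fixed `ε` with abstract weight bounds `ω` (on the
  cut-off region) and `Λ s²` (for `h^{-2a} e^{-|y|²/4s} |v|²` on the initial layer);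
* `exists_carleman_decay` — the choice of the parameters (`a = βρ²/(2 log h(3/2))`, (A.2.13))
  and the passage `ε → 0`.

## References

* G. Seregin, *Lecture notes on regularity theory for the Navier–Stokes equations*, World
  Scientific 2014, App. A.2, Lemma A.1, (A.2.5)–(A.2.17), pp. 210–212.
* L. Escauriaza, G. Seregin, V. Šverák, Russ. Math. Surveys 58:2 (2003) 211–250, §4,
  Lemma 4.2 and the proof of Thm. 4.1.
-/

noncomputable section

open MeasureTheory Set Function Filter Topology Metric
open scoped InnerProductSpace RealInnerProductSpace Nat

namespace Literature.Analysis.FluidPDE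

namespace Carleman

variable {E : Type*} [NormedAddCommGroup E] [InnerProductSpace ℝ E] [FiniteDimensional ℝ E]
  [MeasurableSpace E] [BorelSpace E]
variable {F : Type*} [NormedAddCommGroup F] [InnerProductSpace ℝ F] [CompleteSpace F]

/-! ### The estimate for a fixed cut-off parameter `ε` -/

set_option maxHeartbeats 1600000 in
/-- **Lemma A.1, the Carleman step for fixed `ε`** (Seregin 2014, (A.2.8)–(A.2.11) and
(A.2.16)). Let `v ∈ C²(O)`, `O ⊇ ]0, 7/4] × B̄(0, ρ)` (`ρ ≥ 4`), satisfy on this cylinder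
`|∂ₛv + Δv| ≤ δ(|v| + |∇v|)` with `16 c₀ δ² ≤ 1` (`c₀ = 11e^{4/3}` the constant of the first
Carleman inequality), `|v| ≤ A`, `|∇v|² ≤ A²`; let `a ≥ 2`, and suppose the Carleman weight
`W = h^{-2a}(s) e^{-|y|²/4s}` satisfies `W ≤ ω` on the part of the cylinder where `s ≥ 3/2` or
`|y| ≥ ρ/2`, and `W |v|² ≤ Λ s²` where `s ≤ 1/2`. Then for `0 < ε ≤ 1/4` and `|y₀| + 1 ≤ ρ/2`,
`∫_{]1/2,1[ × B(y₀,1)} W |v|² ≤ 2 |B̄(0,ρ)| ((7/4)(C + 16c₀C² + 16c₀C) A² ω +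
ε (4(C + 16c₀C²) Λ + 16 c₀ C A² ω))`, `C` the constant of the cut-off family
(apply (A.1.1) to `w = η_{ρ,ε} v`, bound `|∂ₛw + Δw|²` by (A.2.7)², absorb the `δ`-terms, and
estimate the error terms on the layer `[ε, 2ε]` and on the cut-off region separately). [cite: Seregin2014, App. A.2 (A.2.8)–(A.2.11)] -/
theorem carleman_step {v : ℝ × E → F} {O : Set (ℝ × E)} {ρ δ A a ω Λ C ε : ℝ} {y₀ : E}
    (hO : IsOpen O) (hρ : 4 ≤ ρ) (hδ : 0 ≤ δ)
    (hδc : 16 * (11 * Real.exp (4 / 3)) * δ ^ 2 ≤ 1) (ha : 2 ≤ a) (hω : 0 ≤ ω)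
    (hΛ : 0 ≤ Λ) (hC : 1 ≤ C) (hε : 0 < ε) (hε4 : ε ≤ 1 / 4) (hy₀ : ‖y₀‖ + 1 ≤ ρ / 2)
    (hcut : ∀ (ρ' ε' : ℝ), 1 ≤ ρ' → 0 < ε' → ε' ≤ 1 →
      ∃ η : ℝ × E → ℝ, ContDiff ℝ 2 η ∧ HasCompactSupport η ∧
        tsupport η ⊆ Icc ε' (7 / 4) ×ˢ closedBall (0 : E) ρ' ∧
        EqOn η (fun _ => 1) (Ioo (2 * ε') (3 / 2) ×ˢ ball (0 : E) (ρ' / 2)) ∧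
        (∀ z, gradSq η z ≤ C ∧ |lap η z| ≤ C ∧ |dt η z| ≤ C / ε') ∧
        (∀ z : ℝ × E, 2 * ε' ≤ z.1 → |dt η z| ≤ C) ∧
        (∀ z : ℝ × E, ‖z.2‖ < ρ' / 2 → gradSq η z = 0))
    (hsub : Ioc (0 : ℝ) (7 / 4) ×ˢ closedBall (0 : E) ρ ⊆ O) (hv : ContDiffOn ℝ 2 v O)
    (hineq : ∀ z ∈ Ioc (0 : ℝ) (7 / 4) ×ˢ closedBall (0 : E) ρ,
      ‖dt v z + lap v z‖ ≤ δ * (‖v z‖ + Real.sqrt (gradSq v z)))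
    (hvA : ∀ z ∈ Ioc (0 : ℝ) (7 / 4) ×ˢ closedBall (0 : E) ρ, ‖v z‖ ≤ A)
    (hgA : ∀ z ∈ Ioc (0 : ℝ) (7 / 4) ×ˢ closedBall (0 : E) ρ, gradSq v z ≤ A ^ 2)
    (hWω : ∀ z ∈ Ioc (0 : ℝ) (7 / 4) ×ˢ closedBall (0 : E) ρ,
      (3 / 2 ≤ z.1 ∨ ρ / 2 ≤ ‖z.2‖) → carlemanWeight a z ≤ ω)
    (hWΛ : ∀ z ∈ Ioc (0 : ℝ) (7 / 4) ×ˢ closedBall (0 : E) ρ, z.1 ≤ 1 / 2 →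
      carlemanWeight a z * ‖v z‖ ^ 2 ≤ Λ * z.1 ^ 2) :
    ∫ z in Ioo (1 / 2 : ℝ) 1 ×ˢ ball y₀ 1, carlemanWeight a z * ‖v z‖ ^ 2 ≤
      2 * ((volume (closedBall (0 : E) ρ)).toReal *
        (7 / 4 * ((C + 16 * (11 * Real.exp (4 / 3)) * C ^ 2 + 16 * (11 * Real.exp (4 / 3)) * C) *
            A ^ 2 * ω) +
          ε * (4 * (C + 16 * (11 * Real.exp (4 / 3)) * C ^ 2) * Λ +
            16 * (11 * Real.exp (4 / 3)) * C * A ^ 2 * ω))) := by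
  set c₀ : ℝ := 11 * Real.exp (4 / 3) with hc₀
  have hc₀0 : 0 < c₀ := by positivity
  have hC0 : 0 ≤ C := zero_le_one.trans hC
  have hρ1 : 1 ≤ ρ := by linarith
  have hρ0 : 0 < ρ := by linarith
  have hε1 : ε ≤ 1 := by linarith
  set b := stdOrthonormalBasis ℝ E with hb
  -- ## the sets
  set Cyl : Set (ℝ × E) := Ioc (0 : ℝ) (7 / 4) ×ˢ closedBall (0 : E) ρ with hCyl
  set K : Set (ℝ × E) := Icc ε (7 / 4) ×ˢ closedBall (0 : E) ρ with hK
  set K₁ : Set (ℝ × E) := Icc ε (2 * ε) ×ˢ closedBall (0 : E) ρ with hK₁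
  set K₂ : Set (ℝ × E) := Ioc (2 * ε) (7 / 4) ×ˢ closedBall (0 : E) ρ with hK₂
  set Bx : Set (ℝ × E) := Ioo (2 * ε) (3 / 2) ×ˢ ball (0 : E) (ρ / 2) with hBx
  set Q : Set (ℝ × E) := Ioo (1 / 2 : ℝ) 1 ×ˢ ball y₀ 1 with hQ
  have hKCyl : K ⊆ Cyl := prod_mono (fun s hs => ⟨by linarith [hs.1], hs.2⟩) subset_rfl
  have hKO : K ⊆ O := hKCyl.trans hsub
  have hKc : IsCompact K := isCompact_Icc.prod (isCompact_closedBall _ _)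
  have hKm : MeasurableSet K := measurableSet_Icc.prod measurableSet_closedBall
  have hK₁m : MeasurableSet K₁ := measurableSet_Icc.prod measurableSet_closedBall
  have hK₂m : MeasurableSet K₂ := measurableSet_Ioc.prod measurableSet_closedBall
  have hQm : MeasurableSet Q := measurableSet_Ioo.prod measurableSet_ball
  have hK₁K : K₁ ⊆ K := prod_mono (Icc_subset_Icc le_rfl (by linarith)) subset_rfl
  have hK₂K : K₂ ⊆ K := prod_mono (fun s hs => ⟨by linarith [hs.1], hs.2⟩) subset_rfl
  have hKsplit : K = K₁ ∪ K₂ := by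
    rw [hK, hK₁, hK₂, ← union_prod, Icc_union_Ioc_eq_Icc (by linarith) (by linarith)]
  have hKdisj : Disjoint K₁ K₂ := by
    rw [hK₁, hK₂, disjoint_left]
    rintro z ⟨⟨-, h1⟩, -⟩ ⟨⟨h2, -⟩, -⟩
    linarith
  have hBxo : IsOpen Bx := isOpen_Ioo.prod isOpen_ball
  have hQBx : Q ⊆ Bx := by
    refine prod_mono (fun s hs => ⟨by linarith [hs.1], by linarith [hs.2]⟩) fun y hy => ?_
    rw [mem_ball, dist_zero_right]
    rw [mem_ball, dist_eq_norm] at hy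
    have : ‖y‖ ≤ ‖y - y₀‖ + ‖y₀‖ := norm_le_norm_sub_add y y₀
    linarith
  have hBxK : Bx ⊆ K := by
    refine prod_mono (fun s hs => ⟨by linarith [hs.1], by linarith [hs.2]⟩) fun y hy => ?_
    rw [mem_ball, dist_zero_right] at hy
    rw [mem_closedBall, dist_zero_right]
    linarith
  have hQK : Q ⊆ K := hQBx.trans hBxK
  -- ## the cut-off and `w = η v`
  obtain ⟨η, hηs, hηc, hηsupp, hη1, hηb, hηdt, hηg0⟩ := hcut ρ ε hρ1 hε hε1
  have hηK : tsupport η ⊆ K := hηsupp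
  have hηO : tsupport η ⊆ O := hηK.trans hKO
  have hη1s : ContDiff ℝ 1 η := hηs.of_le (by norm_num)
  have hvd : DifferentiableOn ℝ v O := hv.differentiableOn (by norm_num)
  set w : ℝ × E → F := fun z => η z • v z with hw
  have hws : ContDiff ℝ 2 w := contDiff_cutoff_smul hO hηs hηO hv
  have hwc : HasCompactSupport w := hasCompactSupport_cutoff_smul hηc
  have hwsupp : tsupport w ⊆ Ioo (0 : ℝ) 2 ×ˢ (univ : Set E) :=
    ((tsupport_smul_subset_left η v).trans hηK).trans
      (prod_mono (fun s hs => ⟨by linarith [hs.1], by linarith [hs.2]⟩) (subset_univ _))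
  have ha0 : 0 < a := by linarith
  -- ## the Carleman inequality for `w`
  have hcarl := carleman_inequality_first_of_contDiff_two ha0 hws hwc hwsupp
  rw [← hc₀] at hcarl
  -- ## vanishing off `K`
  have hw0 : EqOn w (fun _ => (0 : F)) (tsupport η)ᶜ := fun z hz => by
    show η z • v z = 0
    rw [image_eq_zero_of_notMem_tsupport hz, zero_smul]
  have hoff : ∀ z, z ∉ K → w z = 0 ∧ dt w z = 0 ∧ lap w z = 0 ∧ gradSq w z = 0 := by
    intro z hz
    have hz' : z ∈ (tsupport η)ᶜ := fun h => hz (hηK h)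
    exact ⟨hw0 hz', dt_lap_gradSq_eq_zero_of_eqOn_const (isClosed_tsupport η).isOpen_compl hw0 hz'⟩
  -- ## the integrands
  set W : ℝ × E → ℝ := carlemanWeight a with hWdef
  set fL : ℝ × E → ℝ := fun z => W z * (a / z.1 * ‖w z‖ ^ 2 + gradSq w z) with hfL
  set fR : ℝ × E → ℝ := fun z => W z * ‖dt w z + lap w z‖ ^ 2 with hfR
  set Gd : ℝ × E → ℝ := fun z => W z * (η z ^ 2 * ‖v z‖ ^ 2 + η z ^ 2 * gradSq v z / 2)
    with hGd
  set Bd : ℝ × E → ℝ := fun z => W z * (gradSq η z * ‖v z‖ ^ 2) with hBd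
  set R : ℝ × E → ℝ := fun z => W z * ((gradSq η z + 4 * c₀ * (dt η z + lap η z) ^ 2) *
    ‖v z‖ ^ 2 + 16 * c₀ * (gradSq η z * gradSq v z)) with hR
  have hfL0 : ∀ z, z ∉ K → fL z = 0 := fun z hz => by
    obtain ⟨h1, -, -, h4⟩ := hoff z hz
    show W z * (a / z.1 * ‖w z‖ ^ 2 + gradSq w z) = 0
    rw [h1, h4, norm_zero, zero_pow two_ne_zero, mul_zero, zero_add, mul_zero]
  have hfR0 : ∀ z, z ∉ K → fR z = 0 := fun z hz => by
    obtain ⟨-, h2, h3, -⟩ := hoff z hz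
    show W z * ‖dt w z + lap w z‖ ^ 2 = 0
    rw [h2, h3, add_zero, norm_zero, zero_pow two_ne_zero, mul_zero]
  -- ## positivity on `K`
  have hKpos : ∀ z ∈ K, 0 < z.1 := fun z hz => lt_of_lt_of_le hε hz.1.1
  have hW0 : ∀ z ∈ K, 0 ≤ W z := fun z hz => carlemanWeight_nonneg a (hKpos z hz)
  -- ## pointwise inequalities on `K`
  have hnw : ∀ z, ‖w z‖ ^ 2 = η z ^ 2 * ‖v z‖ ^ 2 := fun z => by
    rw [hw]; dsimp only; rw [norm_smul, Real.norm_eq_abs, mul_pow, sq_abs]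
  have hlow : ∀ z ∈ K, Gd z - Bd z ≤ fL z := by
    intro z hz
    have hg := sq_mul_gradSq_div_two_sub_le hO hη1s hηO hvd z
    have h1 : 1 ≤ a / z.1 := by
      rw [le_div_iff₀ (hKpos z hz)]; linarith [hz.1.2]
    have h2 : ‖w z‖ ^ 2 ≤ a / z.1 * ‖w z‖ ^ 2 := le_mul_of_one_le_left (sq_nonneg _) h1
    have h3 : Gd z - Bd z = W z * (‖w z‖ ^ 2 + (η z ^ 2 * gradSq v z / 2 - gradSq η z * ‖v z‖ ^ 2)) := by
      simp only [hGd, hBd, hnw]; ring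
    rw [h3, hfL]
    exact mul_le_mul_of_nonneg_left (add_le_add h2 hg) (hW0 z hz)
  have hup : ∀ z ∈ K, c₀ * fR z ≤ Gd z / 2 + (R z - Bd z) := by
    intro z hz
    have hzO : z ∈ O := hKO hz
    have hP := norm_sq_dt_add_lap_cutoff_smul_le hO hηs hv hzO hδ (hineq z (hKCyl hz))
    have hWz := hW0 z hz
    have hgv : 0 ≤ gradSq v z := gradSq_nonneg _ _
    have hgη : 0 ≤ gradSq η z := gradSq_nonneg _ _
    have hδ' : 4 * c₀ * δ ^ 2 ≤ 1 / 4 := by rw [hc₀]; linarith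
    -- `c₀ W |Pw|² ≤ c₀ W (4δ²η²(|v|²+g) + 4(Pη)²|v|² + 16 gη g)`
    have h1 : c₀ * fR z ≤ c₀ * (W z * (4 * δ ^ 2 * η z ^ 2 * (‖v z‖ ^ 2 + gradSq v z) +
        4 * (dt η z + lap η z) ^ 2 * ‖v z‖ ^ 2 + 16 * (gradSq η z * gradSq v z))) := by
      rw [hfR]
      exact mul_le_mul_of_nonneg_left (mul_le_mul_of_nonneg_left hP hWz) hc₀0.le
    have h2 : c₀ * (W z * (4 * δ ^ 2 * η z ^ 2 * (‖v z‖ ^ 2 + gradSq v z))) ≤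
        W z * (η z ^ 2 * (‖v z‖ ^ 2 + gradSq v z)) / 4 := by
      have hX : 0 ≤ W z * (η z ^ 2 * (‖v z‖ ^ 2 + gradSq v z)) := by positivity
      calc c₀ * (W z * (4 * δ ^ 2 * η z ^ 2 * (‖v z‖ ^ 2 + gradSq v z)))
          = 4 * c₀ * δ ^ 2 * (W z * (η z ^ 2 * (‖v z‖ ^ 2 + gradSq v z))) := by ring
        _ ≤ 1 / 4 * (W z * (η z ^ 2 * (‖v z‖ ^ 2 + gradSq v z))) :=
            mul_le_mul_of_nonneg_right hδ' hX
        _ = _ := by ring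
    have h3 : W z * (η z ^ 2 * (‖v z‖ ^ 2 + gradSq v z)) / 4 ≤ Gd z / 2 := by
      have h0 : 0 ≤ W z * (η z ^ 2 * ‖v z‖ ^ 2) := by positivity
      have e : Gd z / 2 - W z * (η z ^ 2 * (‖v z‖ ^ 2 + gradSq v z)) / 4 =
          W z * (η z ^ 2 * ‖v z‖ ^ 2) / 4 := by
        simp only [hGd]; ring
      linarith
    have h4 : c₀ * (W z * (4 * (dt η z + lap η z) ^ 2 * ‖v z‖ ^ 2 +
        16 * (gradSq η z * gradSq v z))) = R z - Bd z := by
      simp only [hR, hBd]; ring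
    calc c₀ * fR z ≤ _ := h1
      _ = c₀ * (W z * (4 * δ ^ 2 * η z ^ 2 * (‖v z‖ ^ 2 + gradSq v z))) +
            c₀ * (W z * (4 * (dt η z + lap η z) ^ 2 * ‖v z‖ ^ 2 +
              16 * (gradSq η z * gradSq v z))) := by ring
      _ ≤ Gd z / 2 + (R z - Bd z) := by rw [← h4]; linarith
  -- ## continuity and integrability on `K`
  have hWc : ContinuousOn W K := (continuousOn_carlemanWeight a hε).mono fun z hz => by
    show ε / 2 < z.1; linarith [hz.1.1]
  obtain ⟨hvc, -, -, -⟩ := continuousOn_derivatives hO hv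
  obtain ⟨-, hgvc⟩ := continuousOn_lap_gradSq hO hv
  obtain ⟨hηc0, hηdtc, -, -⟩ := continuousOn_derivatives isOpen_univ hηs.contDiffOn
  obtain ⟨hηlapc, hηgc⟩ := continuousOn_lap_gradSq isOpen_univ hηs.contDiffOn
  obtain ⟨hwc0, hwdtc, -, -⟩ := continuousOn_derivatives isOpen_univ hws.contDiffOn
  obtain ⟨hwlapc, hwgc⟩ := continuousOn_lap_gradSq isOpen_univ hws.contDiffOn
  have cv : ContinuousOn (fun z => ‖v z‖ ^ 2) K := ((hvc.mono hKO).norm).pow 2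
  have cg : ContinuousOn (gradSq v) K := hgvc.mono hKO
  have cη : ContinuousOn η K := hηc0.mono (subset_univ _)
  have cηdt : ContinuousOn (dt η) K := hηdtc.mono (subset_univ _)
  have cηlap : ContinuousOn (lap η) K := hηlapc.mono (subset_univ _)
  have cηg : ContinuousOn (gradSq η) K := hηgc.mono (subset_univ _)
  have cw : ContinuousOn (fun z => ‖w z‖ ^ 2) K := ((hwc0.mono (subset_univ _)).norm).pow 2
  have cwg : ContinuousOn (gradSq w) K := hwgc.mono (subset_univ _)
  have cwP : ContinuousOn (fun z => ‖dt w z + lap w z‖ ^ 2) K :=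
    (((hwdtc.mono (subset_univ _)).add (hwlapc.mono (subset_univ _))).norm).pow 2
  have cinv : ContinuousOn (fun z : ℝ × E => a / z.1) K :=
    continuousOn_const.div continuous_fst.continuousOn fun z hz => (hKpos z hz).ne'
  have iK : ∀ {f : ℝ × E → ℝ}, ContinuousOn f K → IntegrableOn f K volume := fun hf =>
    hf.integrableOn_compact hKc
  have ifL : IntegrableOn fL K volume := iK (hWc.mul ((cinv.mul cw).add cwg))
  have ifR : IntegrableOn fR K volume := iK (hWc.mul cwP)
  have iGd : IntegrableOn Gd K volume :=
    iK (hWc.mul (((cη.pow 2).mul cv).add (((cη.pow 2).mul cg).div_const _)))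
  have iBd : IntegrableOn Bd K volume := iK (hWc.mul (cηg.mul cv))
  have iR : IntegrableOn R K volume :=
    iK (hWc.mul (((cηg.add (continuousOn_const.mul ((cηdt.add cηlap).pow 2))).mul cv).add
      (continuousOn_const.mul (cηg.mul cg))))
  -- ## `(1/2) ∫_K Gd ≤ ∫_K R`
  have hmain : (1 / 2) * ∫ z in K, Gd z ≤ ∫ z in K, R z := by
    have e1 : ∫ z in K, (Gd z - Bd z) ≤ ∫ z in K, fL z :=
      setIntegral_mono_on (iGd.sub iBd) ifL hKm hlow
    have e2 : ∫ z in K, fL z = ∫ z, fL z := setIntegral_eq_integral_of_forall_compl_eq_zero hfL0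
    have e3 : ∫ z in K, fR z = ∫ z, fR z := setIntegral_eq_integral_of_forall_compl_eq_zero hfR0
    have e4 : ∫ z in K, c₀ * fR z ≤ ∫ z in K, (Gd z / 2 + (R z - Bd z)) :=
      setIntegral_mono_on (ifR.const_mul c₀) ((iGd.div_const 2).add (iR.sub iBd)) hKm hup
    have e5 : ∫ z in K, c₀ * fR z = c₀ * ∫ z in K, fR z := integral_const_mul c₀ fR
    have e6 : ∫ z in K, (Gd z - Bd z) = (∫ z in K, Gd z) - ∫ z in K, Bd z := integral_sub iGd iBd
    have iRB : Integrable (fun z => R z - Bd z) (volume.restrict K) := iR.sub iBd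
    have iG2 : Integrable (fun z => Gd z / 2) (volume.restrict K) := iGd.div_const 2
    have e7 : ∫ z in K, (Gd z / 2 + (R z - Bd z)) =
        (∫ z in K, Gd z / 2) + ((∫ z in K, R z) - ∫ z in K, Bd z) := by
      rw [integral_add iG2 iRB, integral_sub iR iBd]
    have e8 : ∫ z in K, Gd z / 2 = (∫ z in K, Gd z) / 2 := by
      have := integral_div (2 : ℝ) Gd (μ := volume.restrict K)
      exact this
    have hch : ∫ z, fL z ≤ c₀ * ∫ z, fR z := hcarl
    rw [← e2, ← e3, ← e5] at hch
    linarith [e1.trans (hch.trans e4)]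
  -- ## `∫_Q W |v|² ≤ ∫_K Gd`
  have hQle : ∫ z in Q, W z * ‖v z‖ ^ 2 ≤ ∫ z in K, Gd z := by
    have e1 : ∫ z in Q, W z * ‖v z‖ ^ 2 ≤ ∫ z in Q, Gd z := by
      refine setIntegral_mono_on ((iK (hWc.mul cv)).mono_set hQK) (iGd.mono_set hQK) hQm
        fun z hz => ?_
      have h1 : η z = 1 := hη1 (hQBx hz)
      have h0 : 0 ≤ W z * (gradSq v z / 2) :=
        mul_nonneg (hW0 z (hQK hz)) (div_nonneg (gradSq_nonneg _ _) (by norm_num))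
      have e : Gd z - W z * ‖v z‖ ^ 2 = W z * (gradSq v z / 2) := by
        simp only [hGd, h1]; ring
      linarith
    have e2 : ∫ z in Q, Gd z ≤ ∫ z in K, Gd z := by
      refine setIntegral_mono_set iGd ?_ (Eventually.of_forall hQK)
      refine (ae_restrict_iff' hKm).2 (Eventually.of_forall fun z hz => ?_)
      simp only [hGd, Pi.zero_apply]
      have := hW0 z hz
      have : 0 ≤ gradSq v z := gradSq_nonneg _ _
      positivity
    exact e1.trans e2
  -- ## the error integral: `∫_K R ≤ |B̄ρ| (7/4 M₂ + ε M₁)`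
  set Vρ : ℝ := (volume (closedBall (0 : E) ρ)).toReal with hVρ
  have hVρ0 : 0 ≤ Vρ := ENNReal.toReal_nonneg
  set M₂ : ℝ := (C + 16 * c₀ * C ^ 2 + 16 * c₀ * C) * A ^ 2 * ω with hM₂
  set M₁ : ℝ := 4 * (C + 16 * c₀ * C ^ 2) * Λ + 16 * c₀ * C * A ^ 2 * ω with hM₁
  have hM₂0 : 0 ≤ M₂ := by positivity
  have hM₁0 : 0 ≤ M₁ := by positivity
  -- pointwise on `K₂`
  have hRK₂ : ∀ z ∈ K₂, R z ≤ M₂ := by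
    intro z hz
    have hzK : z ∈ K := hK₂K hz
    have hzC : z ∈ Cyl := hKCyl hzK
    have hWz := hW0 z hzK
    by_cases hbx : z.1 < 3 / 2 ∧ ‖z.2‖ < ρ / 2
    · have hzBx : z ∈ Bx := ⟨⟨hz.1.1, hbx.1⟩, by rw [mem_ball, dist_zero_right]; exact hbx.2⟩
      obtain ⟨h1, h2, h3⟩ := dt_lap_gradSq_eq_zero_of_eqOn_const hBxo hη1 hzBx
      simp only [hR, h1, h2, h3]
      norm_num
      exact hM₂0
    · have hWle : W z ≤ ω := hWω z hzC (by
        by_contra h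
        push Not at h
        exact hbx ⟨h.1, h.2⟩)
      obtain ⟨hg1, hl1, -⟩ := hηb z
      have hd1 : |dt η z| ≤ C := hηdt z hz.1.1.le
      have hv1 : ‖v z‖ ^ 2 ≤ A ^ 2 := pow_le_pow_left₀ (norm_nonneg _) (hvA z hzC) 2
      have hgv1 : gradSq v z ≤ A ^ 2 := hgA z hzC
      have hgv0 : 0 ≤ gradSq v z := gradSq_nonneg _ _
      have hgη0 : 0 ≤ gradSq η z := gradSq_nonneg _ _
      have hP : (dt η z + lap η z) ^ 2 ≤ 4 * C ^ 2 := by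
        have h1 : |dt η z + lap η z| ≤ 2 * C :=
          (abs_add_le _ _).trans (by linarith [add_le_add hd1 hl1])
        calc (dt η z + lap η z) ^ 2 = |dt η z + lap η z| ^ 2 := (sq_abs _).symm
          _ ≤ (2 * C) ^ 2 := pow_le_pow_left₀ (abs_nonneg _) h1 2
          _ = 4 * C ^ 2 := by ring
      have hX : (gradSq η z + 4 * c₀ * (dt η z + lap η z) ^ 2) * ‖v z‖ ^ 2 +
          16 * c₀ * (gradSq η z * gradSq v z) ≤
          (C + 16 * c₀ * C ^ 2 + 16 * c₀ * C) * A ^ 2 := by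
        have e0 : gradSq η z + 4 * c₀ * (dt η z + lap η z) ^ 2 ≤ C + 4 * c₀ * (4 * C ^ 2) :=
          add_le_add hg1 (mul_le_mul_of_nonneg_left hP (by positivity))
        have e1 : (gradSq η z + 4 * c₀ * (dt η z + lap η z) ^ 2) * ‖v z‖ ^ 2 ≤
            (C + 4 * c₀ * (4 * C ^ 2)) * A ^ 2 :=
          mul_le_mul e0 hv1 (sq_nonneg _) (by positivity)
        have e2 : 16 * c₀ * (gradSq η z * gradSq v z) ≤ 16 * c₀ * (C * A ^ 2) :=
          mul_le_mul_of_nonneg_left (mul_le_mul hg1 hgv1 hgv0 hC0) (by positivity)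
        calc _ ≤ (C + 4 * c₀ * (4 * C ^ 2)) * A ^ 2 + 16 * c₀ * (C * A ^ 2) := add_le_add e1 e2
          _ = (C + 16 * c₀ * C ^ 2 + 16 * c₀ * C) * A ^ 2 := by ring
      have hX0 : 0 ≤ (gradSq η z + 4 * c₀ * (dt η z + lap η z) ^ 2) * ‖v z‖ ^ 2 +
          16 * c₀ * (gradSq η z * gradSq v z) := by positivity
      calc R z = W z * ((gradSq η z + 4 * c₀ * (dt η z + lap η z) ^ 2) * ‖v z‖ ^ 2 +
            16 * c₀ * (gradSq η z * gradSq v z)) := rfl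
        _ ≤ ω * ((C + 16 * c₀ * C ^ 2 + 16 * c₀ * C) * A ^ 2) := mul_le_mul hWle hX hX0 hω
        _ = M₂ := by rw [hM₂]; ring
  -- pointwise on `K₁`
  have hRK₁ : ∀ z ∈ K₁, R z ≤ M₁ := by
    intro z hz
    have hzK : z ∈ K := hK₁K hz
    have hzC : z ∈ Cyl := hKCyl hzK
    have hWz := hW0 z hzK
    have hs0 : 0 < z.1 := hKpos z hzK
    have hs2 : z.1 ≤ 2 * ε := hz.1.2
    have hs1 : z.1 ≤ 1 / 2 := by linarith
    obtain ⟨hg1, hl1, hd1⟩ := hηb z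
    have hgη0 : 0 ≤ gradSq η z := gradSq_nonneg _ _
    have hgv0 : 0 ≤ gradSq v z := gradSq_nonneg _ _
    have hgv1 : gradSq v z ≤ A ^ 2 := hgA z hzC
    -- the `|v|²` term, through `W |v|² ≤ Λ s²`
    have hε2 : 0 < ε ^ 2 := by positivity
    have hcoef : gradSq η z + 4 * c₀ * (dt η z + lap η z) ^ 2 ≤ (C + 16 * c₀ * C ^ 2) / ε ^ 2 := by
      have e1 : gradSq η z ≤ C / ε ^ 2 := hg1.trans (le_div_self hC0 hε2 (pow_le_one₀ hε.le hε1))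
      have e2 : |dt η z + lap η z| ≤ 2 * C / ε := by
        have : C ≤ C / ε := le_div_self hC0 hε hε1
        calc |dt η z + lap η z| ≤ |dt η z| + |lap η z| := abs_add_le _ _
          _ ≤ C / ε + C / ε := add_le_add hd1 (hl1.trans this)
          _ = 2 * C / ε := by ring
      have e3 : (dt η z + lap η z) ^ 2 ≤ (2 * C / ε) ^ 2 := by
        rw [← sq_abs]; exact pow_le_pow_left₀ (abs_nonneg _) e2 2
      calc gradSq η z + 4 * c₀ * (dt η z + lap η z) ^ 2 ≤ C / ε ^ 2 + 4 * c₀ * (2 * C / ε) ^ 2 := by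
            gcongr
        _ = (C + 16 * c₀ * C ^ 2) / ε ^ 2 := by field_simp; ring
    have hterm1 : W z * ((gradSq η z + 4 * c₀ * (dt η z + lap η z) ^ 2) * ‖v z‖ ^ 2) ≤
        4 * (C + 16 * c₀ * C ^ 2) * Λ := by
      have e1 : W z * ((gradSq η z + 4 * c₀ * (dt η z + lap η z) ^ 2) * ‖v z‖ ^ 2) =
          (gradSq η z + 4 * c₀ * (dt η z + lap η z) ^ 2) * (W z * ‖v z‖ ^ 2) := by ring
      rw [e1]
      have e2 := hWΛ z hzC hs1
      have e3 : 0 ≤ W z * ‖v z‖ ^ 2 := by positivity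
      calc (gradSq η z + 4 * c₀ * (dt η z + lap η z) ^ 2) * (W z * ‖v z‖ ^ 2)
          ≤ (C + 16 * c₀ * C ^ 2) / ε ^ 2 * (Λ * z.1 ^ 2) := mul_le_mul hcoef e2 e3 (by positivity)
        _ ≤ (C + 16 * c₀ * C ^ 2) / ε ^ 2 * (Λ * (2 * ε) ^ 2) := by
            gcongr
        _ = 4 * (C + 16 * c₀ * C ^ 2) * Λ := by field_simp; ring
    -- the gradient term, through `W ≤ ω` on the annulus and `∇η = 0` inside
    have hterm2 : W z * (16 * c₀ * (gradSq η z * gradSq v z)) ≤ 16 * c₀ * C * A ^ 2 * ω := by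
      by_cases hy : ‖z.2‖ < ρ / 2
      · rw [hηg0 z hy]
        norm_num
        positivity
      · have hWle : W z ≤ ω := hWω z hzC (Or.inr (not_lt.1 hy))
        calc W z * (16 * c₀ * (gradSq η z * gradSq v z)) ≤ ω * (16 * c₀ * (C * A ^ 2)) :=
              mul_le_mul hWle (mul_le_mul_of_nonneg_left (mul_le_mul hg1 hgv1 hgv0 hC0)
                (by positivity)) (by positivity) hω
          _ = 16 * c₀ * C * A ^ 2 * ω := by ring
    calc R z = W z * ((gradSq η z + 4 * c₀ * (dt η z + lap η z) ^ 2) * ‖v z‖ ^ 2) +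
          W z * (16 * c₀ * (gradSq η z * gradSq v z)) := by simp only [hR]; ring
      _ ≤ 4 * (C + 16 * c₀ * C ^ 2) * Λ + 16 * c₀ * C * A ^ 2 * ω := add_le_add hterm1 hterm2
      _ = M₁ := by rw [hM₁]
  -- volumes
  have hvol : (volume : Measure (ℝ × E)) = (volume : Measure ℝ).prod (volume : Measure E) := rfl
  have hVK₂ : (volume K₂).toReal ≤ 7 / 4 * Vρ := by
    rw [hK₂, hvol, Measure.prod_prod, ENNReal.toReal_mul, Real.volume_Ioc,
      ENNReal.toReal_ofReal (by linarith)]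
    exact mul_le_mul_of_nonneg_right (by linarith) hVρ0
  have hVK₁ : (volume K₁).toReal = ε * Vρ := by
    rw [hK₁, hvol, Measure.prod_prod, ENNReal.toReal_mul, Real.volume_Icc,
      ENNReal.toReal_ofReal (by linarith)]
    ring
  have hK₂fin : volume K₂ < ⊤ := (hKc.measure_lt_top.trans_le' (measure_mono hK₂K))
  have hK₁fin : volume K₁ < ⊤ := (hKc.measure_lt_top.trans_le' (measure_mono hK₁K))
  have hRle : ∫ z in K, R z ≤ Vρ * (7 / 4 * M₂ + ε * M₁) := by
    rw [hKsplit, setIntegral_union hKdisj hK₂m (iR.mono_set hK₁K) (iR.mono_set hK₂K)]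
    have e1 : ∫ z in K₁, R z ≤ ∫ _ in K₁, M₁ :=
      setIntegral_mono_on (iR.mono_set hK₁K) (integrableOn_const hK₁fin.ne) hK₁m hRK₁
    have e2 : ∫ z in K₂, R z ≤ ∫ _ in K₂, M₂ :=
      setIntegral_mono_on (iR.mono_set hK₂K) (integrableOn_const hK₂fin.ne) hK₂m hRK₂
    rw [setIntegral_const, measureReal_def, hVK₁, smul_eq_mul] at e1
    rw [setIntegral_const, measureReal_def, smul_eq_mul] at e2
    have e3 : (volume K₂).toReal * M₂ ≤ 7 / 4 * Vρ * M₂ := mul_le_mul_of_nonneg_right hVK₂ hM₂0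
    have e4 : ε * Vρ * M₁ + 7 / 4 * Vρ * M₂ = Vρ * (7 / 4 * M₂ + ε * M₁) := by ring
    linarith
  -- ## conclusion
  have hfin : ∫ z in Q, W z * ‖v z‖ ^ 2 ≤ 2 * (Vρ * (7 / 4 * M₂ + ε * M₁)) := by
    linarith [hQle, hmain, hRle]
  simpa only [hM₂, hM₁, hc₀] using hfin

/-! ### The choice of the parameters and the limit `ε → 0` -/

omit [InnerProductSpace ℝ E] [FiniteDimensional ℝ E] [MeasurableSpace E] [BorelSpace E]
  [CompleteSpace F] in
/-- The closed inner cylinder `[1/2, 1] × B̄(y₀, 1)` lies in `]0, 7/4] × B̄(0, ρ)` when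
`|y₀| + 1 ≤ ρ`. [folklore] -/
theorem inner_closure_subset_cylinder {ρ : ℝ} {y₀ : E} (hy₀ : ‖y₀‖ + 1 ≤ ρ) :
    Icc (1 / 2 : ℝ) 1 ×ˢ closedBall y₀ 1 ⊆ Ioc (0 : ℝ) (7 / 4) ×ˢ closedBall (0 : E) ρ := by
  refine prod_mono (fun s hs => ⟨by linarith [hs.1], by linarith [hs.2]⟩) fun y hy => ?_
  rw [mem_closedBall, dist_eq_norm] at hy
  rw [mem_closedBall, dist_zero_right]
  have : ‖y‖ ≤ ‖y - y₀‖ + ‖y₀‖ := norm_le_norm_sub_add y y₀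
  linarith

omit [CompleteSpace F] in
/-- A function continuous on `[1/2, 1] × B̄(y₀, 1)` is integrable on `]1/2, 1[ × B(y₀, 1)`.
[folklore] -/
theorem integrableOn_inner_of_continuousOn {f : ℝ × E → ℝ} {y₀ : E}
    (hf : ContinuousOn f (Icc (1 / 2 : ℝ) 1 ×ˢ closedBall y₀ 1)) :
    IntegrableOn f (Ioo (1 / 2 : ℝ) 1 ×ˢ ball y₀ 1) volume :=
  (hf.integrableOn_compact (isCompact_Icc.prod (isCompact_closedBall _ _))).mono_set
    (prod_mono Ioo_subset_Icc_self ball_subset_closedBall)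

set_option maxHeartbeats 800000 in
/-- **Lemma A.1 in rescaled variables** (Seregin 2014, App. A.2, (A.2.5)–(A.2.17)). There are
constants `β ∈ (0, 1/28]`, `δ₀ > 0`, `ρ₀ ≥ 4`, `K > 0`, depending only on `E`, such that: if
`v ∈ C²(O)`, `O ⊇ ]0, 7/4] × B̄(0, ρ)` with `ρ ≥ ρ₀`, satisfies on this cylinder the backward
heat inequality `|∂ₛv + Δv| ≤ δ(|v| + |∇v|)` with `0 ≤ δ ≤ δ₀` ((A.2.5) with (A.2.9)), the
bounds `|v| ≤ A`, `|∇v|² ≤ A²` (the constant `A` of (A.2.10)), and vanishes to infinite order at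
the origin, `|v(y, s)| ≤ C_k (|y| + √s)^k` for all `k` ((A.2.6)), then for every centre `y₀`
with `|y₀| ≤ √(2β) ρ/2` (`= μρ/2`, `μ = √(2β)`, (A.2.16)–(A.2.17)),
`∫_{]1/2,1[ × B(y₀,1)} |v|² ≤ K A² e^{-βρ²/4}`.
Proof: the first Carleman inequality with `a = βρ²/(2 log h(3/2))` ((A.2.13)) applied to
`η_{ρ,ε} v` (`carleman_step`), the weight bounds of `UniqueContinuationRescale.lean` on the
cut-off region (`≤ e^{-βρ²}`, (A.2.11)–(A.2.15)) and on the initial layer (where the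
infinite-order vanishing gives `h^{-2a} e^{-|y|²/4s}|v|² ≤ Λ s²`, so that the layer term is
`O(ε)`), the limit `ε → 0`, the lower bound `h^{-2a} e^{-|y|²/4s} ≥ e^{-1} e^{-μ²ρ²/4}` on the
inner cylinder ((A.2.16)), and `|B̄(0,ρ)| = ρⁿ |B̄(0,1)|`, `ρⁿ e^{-βρ²/4} ≤ n!(4/β)ⁿ`. [cite: Seregin2014, App. A.2 Lemma A.1 (A.2.15)–(A.2.17)] -/
theorem exists_carleman_decay :
    ∃ β δ₀ ρ₀ K : ℝ, 0 < β ∧ β ≤ 1 / 28 ∧ 0 < δ₀ ∧ 4 ≤ ρ₀ ∧ 0 < K ∧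
    ∀ (v : ℝ × E → F) (O : Set (ℝ × E)) (ρ δ A : ℝ) (y₀ : E),
      IsOpen O → ρ₀ ≤ ρ → 0 ≤ δ → δ ≤ δ₀ → ‖y₀‖ ≤ Real.sqrt (2 * β) * ρ / 2 →
      Ioc (0 : ℝ) (7 / 4) ×ˢ closedBall (0 : E) ρ ⊆ O → ContDiffOn ℝ 2 v O →
      (∀ z ∈ Ioc (0 : ℝ) (7 / 4) ×ˢ closedBall (0 : E) ρ,
        ‖dt v z + lap v z‖ ≤ δ * (‖v z‖ + Real.sqrt (gradSq v z))) →
      (∀ z ∈ Ioc (0 : ℝ) (7 / 4) ×ˢ closedBall (0 : E) ρ, ‖v z‖ ≤ A) →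
      (∀ z ∈ Ioc (0 : ℝ) (7 / 4) ×ˢ closedBall (0 : E) ρ, gradSq v z ≤ A ^ 2) →
      (∀ k : ℕ, ∃ Ck : ℝ, ∀ z ∈ Ioc (0 : ℝ) (7 / 4) ×ˢ closedBall (0 : E) ρ,
        ‖v z‖ ≤ Ck * (‖z.2‖ + Real.sqrt z.1) ^ k) →
      ∫ z in Ioo (1 / 2 : ℝ) 1 ×ˢ ball y₀ 1, ‖v z‖ ^ 2 ≤
        K * A ^ 2 * Real.exp (-(β / 4 * ρ ^ 2)) := by
  obtain ⟨C, hC1, hcut⟩ := exists_ucCutoff (E := E)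
  have hC0 : 0 ≤ C := zero_le_one.trans hC1
  set c₀ : ℝ := 11 * Real.exp (4 / 3) with hc₀
  have hc₀0 : 0 < c₀ := by positivity
  -- ## the parameters
  set L : ℝ := Real.log (hW (3 / 2)) with hL
  have hL0 : 0 < L := log_hW_three_halves_pos
  have hL1 : L < 1 := log_hW_three_halves_lt_one
  set β : ℝ := min (L / 16) (1 / 28) with hβ
  have hβL : β ≤ L / 16 := min_le_left _ _
  have hβ28 : β ≤ 1 / 28 := min_le_right _ _
  have hβ0 : 0 < β := lt_min (by linarith) (by norm_num)
  set κ : ℝ := β / (2 * L) with hκ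
  have hκ0 : 0 < κ := by positivity
  have hκ32 : κ ≤ 1 / 32 := by
    rw [hκ, div_le_iff₀ (by positivity)]; linarith
  have hκL : 2 * κ * L = β := by rw [hκ]; field_simp
  set μ : ℝ := Real.sqrt (2 * β) with hμ
  have hμ0 : 0 ≤ μ := Real.sqrt_nonneg _
  have hμ2 : μ ^ 2 = 2 * β := Real.sq_sqrt (by linarith)
  have hμhalf : μ ≤ 1 / 2 := by
    rw [hμ, show (1 / 2 : ℝ) = Real.sqrt (1 / 4) by
      rw [show (1 / 4 : ℝ) = (1 / 2) ^ 2 by norm_num, Real.sqrt_sq (by norm_num)]]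
    exact Real.sqrt_le_sqrt (by linarith)
  set δ₀ : ℝ := 1 / (4 * Real.sqrt c₀) with hδ₀
  have hsc₀ : 0 < Real.sqrt c₀ := Real.sqrt_pos.2 hc₀0
  have hδ₀0 : 0 < δ₀ := by positivity
  set ρ₀ : ℝ := max 4 (Real.sqrt (2 / κ)) with hρ₀
  set n : ℕ := Module.finrank ℝ E with hn
  set V₁ : ℝ := (volume (closedBall (0 : E) 1)).toReal with hV₁
  have hV₁0 : 0 ≤ V₁ := ENNReal.toReal_nonneg
  set Kc : ℝ := C + 16 * c₀ * C ^ 2 + 16 * c₀ * C with hKc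
  have hKc0 : 0 ≤ Kc := by positivity
  set K : ℝ := Real.exp 1 * (7 / 2) * Kc * V₁ * (n ! / (β / 4) ^ n) + 1 with hK
  have hKpos : 0 < K := by positivity
  refine ⟨β, δ₀, ρ₀, K, hβ0, hβ28, hδ₀0, le_max_left _ _, hKpos, ?_⟩
  intro v O ρ δ A y₀ hO hρ hδ hδδ₀ hy₀ hsub hv hineq hvA hgA hvan
  -- ## derived quantities
  have hρ4 : 4 ≤ ρ := (le_max_left _ _).trans hρ
  have hρ0 : 0 < ρ := by linarith
  have hρ1 : 1 ≤ ρ := by linarith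
  set a : ℝ := κ * ρ ^ 2 with ha
  have ha0 : 0 ≤ a := by positivity
  have ha2 : 2 ≤ a := by
    have h1 : Real.sqrt (2 / κ) ≤ ρ := (le_max_right _ _).trans hρ
    have h2 : 2 / κ ≤ ρ ^ 2 := by
      calc 2 / κ = Real.sqrt (2 / κ) ^ 2 := (Real.sq_sqrt (by positivity)).symm
        _ ≤ ρ ^ 2 := pow_le_pow_left₀ (Real.sqrt_nonneg _) h1 2
    rw [ha]
    rw [div_le_iff₀ hκ0] at h2
    linarith
  have hδc : 16 * (11 * Real.exp (4 / 3)) * δ ^ 2 ≤ 1 := by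
    rw [← hc₀]
    have h1 : δ * (4 * Real.sqrt c₀) ≤ 1 := by
      rw [← le_div_iff₀ (by positivity)]; exact hδδ₀
    have h2 : 0 ≤ δ * (4 * Real.sqrt c₀) := by positivity
    have h3 : (δ * (4 * Real.sqrt c₀)) ^ 2 ≤ 1 := pow_le_one₀ h2 h1
    have h4 : Real.sqrt c₀ ^ 2 = c₀ := Real.sq_sqrt hc₀0.le
    have e : (δ * (4 * Real.sqrt c₀)) ^ 2 = 16 * Real.sqrt c₀ ^ 2 * δ ^ 2 := by ring
    rw [e, h4] at h3
    exact h3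
  have hy₀' : ‖y₀‖ + 1 ≤ ρ / 2 := by
    have : Real.sqrt (2 * β) * ρ / 2 ≤ (1 / 2) * ρ / 2 := by
      rw [← hμ]; gcongr
    linarith
  -- ## the weight bound on the cut-off region: `ω = e^{-βρ²}`
  set ω : ℝ := Real.exp (-(β * ρ ^ 2)) with hω
  have hω0 : 0 ≤ ω := (Real.exp_pos _).le
  set Cyl : Set (ℝ × E) := Ioc (0 : ℝ) (7 / 4) ×ˢ closedBall (0 : E) ρ with hCyl
  have hWω : ∀ z ∈ Cyl, (3 / 2 ≤ z.1 ∨ ρ / 2 ≤ ‖z.2‖) → carlemanWeight a z ≤ ω := by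
    intro z hz h
    have hz0 : 0 < z.1 := hz.1.1
    have hz74 : z.1 ≤ 7 / 4 := hz.1.2
    rcases h with h | h
    · refine (carlemanWeight_le_exp_of_three_halves_le ha0 h (by linarith)).trans (le_of_eq ?_)
      rw [hω, ← hL, ha]
      congr 1
      rw [← hκL]
      ring
    · rcases le_total z.1 1 with h1 | h1
      · have haρ : 2 * a ≤ ρ ^ 2 / 16 := by
          rw [ha]
          calc 2 * (κ * ρ ^ 2) = 2 * κ * ρ ^ 2 := by ring
            _ ≤ 2 * (1 / 32) * ρ ^ 2 := by gcongr
            _ = ρ ^ 2 / 16 := by ring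
        refine (carlemanWeight_le_exp_neg_of_le_one ha0 hρ0.le haρ hz0 h1 h).trans ?_
        rw [hω, Real.exp_le_exp, neg_le_neg_iff, ha]
        have h2κ : 2 * κ = β / L := by rw [hκ]; field_simp
        have hβκ : β ≤ 2 * κ := by
          rw [h2κ, le_div_iff₀ hL0]
          have : β * L ≤ β * 1 := mul_le_mul_of_nonneg_left hL1.le hβ0.le
          linarith
        calc β * ρ ^ 2 ≤ 2 * κ * ρ ^ 2 := mul_le_mul_of_nonneg_right hβκ (sq_nonneg _)
          _ = 2 * (κ * ρ ^ 2) := by ring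
      · refine (carlemanWeight_le_exp_neg_of_one_le ha0 hρ0.le h1 hz74 h).trans ?_
        rw [hω, Real.exp_le_exp, neg_le_neg_iff]
        calc β * ρ ^ 2 ≤ 1 / 28 * ρ ^ 2 := mul_le_mul_of_nonneg_right hβ28 (sq_nonneg _)
          _ = ρ ^ 2 / 28 := by ring
  -- ## the initial layer: `W |v|² ≤ Λ s²` from the infinite-order vanishing (A.2.6)
  set k : ℕ := ⌈2 * a⌉₊ + 2 with hk
  have hk2a : 2 * a + 2 ≤ (k : ℝ) := by
    rw [hk]; push_cast; linarith [Nat.le_ceil (2 * a)]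
  obtain ⟨Ck, hCk⟩ := hvan k
  set Ck' : ℝ := max Ck 0 with hCk'
  have hCk'0 : 0 ≤ Ck' := le_max_right _ _
  set Dk : ℝ := 4 ^ k * (4 ^ k * k ! + 1) with hDk
  have hDk0 : 0 ≤ Dk := by positivity
  set Λ : ℝ := Ck' ^ 2 * Dk with hΛ
  have hΛ0 : 0 ≤ Λ := by positivity
  have hWΛ : ∀ z ∈ Cyl, z.1 ≤ 1 / 2 → carlemanWeight a z * ‖v z‖ ^ 2 ≤ Λ * z.1 ^ 2 := by
    intro z hz hz2
    have hs0 : 0 < z.1 := hz.1.1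
    have hs1 : z.1 ≤ 1 := by linarith
    have hW1 := carlemanWeight_le_rpow_mul_exp (E := E) ha0 hs0 hs1
    have hv1 : ‖v z‖ ≤ Ck' * (‖z.2‖ + Real.sqrt z.1) ^ k :=
      (hCk z hz).trans (mul_le_mul_of_nonneg_right (le_max_left _ _) (by positivity))
    have hv2 : ‖v z‖ ^ 2 ≤ Ck' ^ 2 * (‖z.2‖ + Real.sqrt z.1) ^ (2 * k) := by
      have := pow_le_pow_left₀ (norm_nonneg _) hv1 2
      rw [mul_pow, ← pow_mul, mul_comm k 2] at this
      exact this
    have hG := exp_neg_sq_div_mul_add_sqrt_pow_le k ‖z.2‖ hs0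
    have hpow : z.1 ^ (-(2 * a)) * z.1 ^ k ≤ z.1 ^ 2 := by
      rw [← Real.rpow_natCast z.1 k, ← Real.rpow_add hs0, ← Real.rpow_two]
      exact Real.rpow_le_rpow_of_exponent_ge hs0 hs1 (by linarith)
    have hr0 : 0 ≤ z.1 ^ (-(2 * a)) := Real.rpow_nonneg hs0.le _
    calc carlemanWeight a z * ‖v z‖ ^ 2
        ≤ (z.1 ^ (-(2 * a)) * Real.exp (-‖z.2‖ ^ 2 / (4 * z.1))) *
            (Ck' ^ 2 * (‖z.2‖ + Real.sqrt z.1) ^ (2 * k)) :=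
          mul_le_mul hW1 hv2 (sq_nonneg _) (by positivity)
      _ = Ck' ^ 2 * z.1 ^ (-(2 * a)) *
            (Real.exp (-‖z.2‖ ^ 2 / (4 * z.1)) * (‖z.2‖ + Real.sqrt z.1) ^ (2 * k)) := by ring
      _ ≤ Ck' ^ 2 * z.1 ^ (-(2 * a)) * (Dk * z.1 ^ k) :=
          mul_le_mul_of_nonneg_left hG (by positivity)
      _ = Ck' ^ 2 * Dk * (z.1 ^ (-(2 * a)) * z.1 ^ k) := by ring
      _ ≤ Ck' ^ 2 * Dk * z.1 ^ 2 := mul_le_mul_of_nonneg_left hpow (by positivity)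
      _ = Λ * z.1 ^ 2 := by rw [hΛ]
  -- ## the Carleman step for every `ε ∈ (0, 1/4]`, and `ε → 0`
  set Vρ : ℝ := (volume (closedBall (0 : E) ρ)).toReal with hVρ
  have hVρ0 : 0 ≤ Vρ := ENNReal.toReal_nonneg
  set M₂ : ℝ := Kc * A ^ 2 * ω with hM₂
  set M₁ : ℝ := 4 * (C + 16 * c₀ * C ^ 2) * Λ + 16 * c₀ * C * A ^ 2 * ω with hM₁
  have hM₁0 : 0 ≤ M₁ := by positivity
  have hM₂0 : 0 ≤ M₂ := by positivity
  set Q : Set (ℝ × E) := Ioo (1 / 2 : ℝ) 1 ×ˢ ball y₀ 1 with hQ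
  have key : ∀ ε : ℝ, 0 < ε → ε ≤ 1 / 4 →
      ∫ z in Q, carlemanWeight a z * ‖v z‖ ^ 2 ≤ 2 * (Vρ * (7 / 4 * M₂ + ε * M₁)) := by
    intro ε hε hε4
    exact carleman_step hO hρ4 hδ hδc ha2 hω0 hΛ0 hC1 hε hε4 hy₀' hcut hsub hv hineq
      hvA hgA hWω hWΛ
  have hlim : ∫ z in Q, carlemanWeight a z * ‖v z‖ ^ 2 ≤ 2 * (Vρ * (7 / 4 * M₂)) := by
    refine le_of_forall_pos_le_add fun θ hθ => ?_
    have hden : 0 < 2 * Vρ * M₁ + 1 := by positivity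
    set ε : ℝ := min (1 / 4) (θ / (2 * Vρ * M₁ + 1)) with hεdef
    have hε0 : 0 < ε := lt_min (by norm_num) (div_pos hθ hden)
    have hε4 : ε ≤ 1 / 4 := min_le_left _ _
    have hεθ : ε ≤ θ / (2 * Vρ * M₁ + 1) := min_le_right _ _
    have h1 := key ε hε0 hε4
    have h2 : 2 * (Vρ * (ε * M₁)) ≤ θ := by
      rw [le_div_iff₀ hden] at hεθ
      have e : ε * (2 * Vρ * M₁ + 1) = 2 * (Vρ * (ε * M₁)) + ε := by ring
      linarith
    calc ∫ z in Q, carlemanWeight a z * ‖v z‖ ^ 2 ≤ 2 * (Vρ * (7 / 4 * M₂ + ε * M₁)) := h1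
      _ = 2 * (Vρ * (7 / 4 * M₂)) + 2 * (Vρ * (ε * M₁)) := by ring
      _ ≤ 2 * (Vρ * (7 / 4 * M₂)) + θ := by linarith
  -- ## the lower bound of the weight on `Q`
  set w₀ : ℝ := Real.exp (-(μ ^ 2 * ρ ^ 2 / 4 + 1)) with hw₀
  have hw₀0 : 0 < w₀ := Real.exp_pos _
  have hWlow : ∀ z ∈ Q, w₀ ≤ carlemanWeight a z := by
    intro z hz
    have hz1 : 1 / 2 ≤ z.1 := hz.1.1.le
    have hz2 : z.1 ≤ 1 := hz.1.2.le
    refine le_trans ?_ (exp_neg_le_carlemanWeight ha0 hz1 hz2)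
    rw [hw₀, Real.exp_le_exp, neg_le_neg_iff]
    have hy : ‖z.2‖ ≤ μ * ρ / 2 + 1 := by
      have h1 : ‖z.2 - y₀‖ < 1 := by rw [← dist_eq_norm]; exact hz.2
      have h2 : ‖z.2‖ ≤ ‖z.2 - y₀‖ + ‖y₀‖ := norm_le_norm_sub_add _ _
      have h3 : ‖y₀‖ ≤ μ * ρ / 2 := by rw [hμ]; linarith [hy₀]
      linarith
    have hy0 : 0 ≤ ‖z.2‖ := norm_nonneg _
    have hμρ : 0 ≤ μ * ρ / 2 := by positivity
    have h1 : ‖z.2‖ ^ 2 ≤ (μ * ρ / 2 + 1) ^ 2 := pow_le_pow_left₀ hy0 hy 2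
    nlinarith only [h1, sq_nonneg (μ * ρ / 2 - 1)]
  -- ## `w₀ ∫_Q |v|² ≤ ∫_Q W |v|²`
  have hy₀'' : ‖y₀‖ + 1 ≤ ρ := by linarith
  have hK'sub := inner_closure_subset_cylinder (E := E) hy₀''
  have cW : ContinuousOn (carlemanWeight a) (Icc (1 / 2 : ℝ) 1 ×ˢ closedBall y₀ 1) :=
    (continuousOn_carlemanWeight a (by norm_num : (0 : ℝ) < 1 / 2)).mono fun z hz => by
      show 1 / 2 / 2 < z.1
      linarith [hz.1.1]
  have cv : ContinuousOn (fun z => ‖v z‖ ^ 2) (Icc (1 / 2 : ℝ) 1 ×ˢ closedBall y₀ 1) :=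
    ((hv.continuousOn.mono (hK'sub.trans hsub)).norm).pow 2
  have iv : IntegrableOn (fun z => ‖v z‖ ^ 2) Q volume := integrableOn_inner_of_continuousOn cv
  have iWv : IntegrableOn (fun z => carlemanWeight a z * ‖v z‖ ^ 2) Q volume :=
    integrableOn_inner_of_continuousOn (cW.mul cv)
  have hQm : MeasurableSet Q := measurableSet_Ioo.prod measurableSet_ball
  have hlowint : w₀ * ∫ z in Q, ‖v z‖ ^ 2 ≤ ∫ z in Q, carlemanWeight a z * ‖v z‖ ^ 2 := by
    rw [← integral_const_mul]
    exact setIntegral_mono_on (iv.const_mul w₀) iWv hQm fun z hz =>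
      mul_le_mul_of_nonneg_right (hWlow z hz) (sq_nonneg _)
  -- ## conclusion
  have hVρeq : Vρ = ρ ^ n * V₁ := by
    rw [hVρ, Measure.addHaar_closedBall' volume (0 : E) hρ0.le, ENNReal.toReal_mul,
      ENNReal.toReal_ofReal (by positivity), hV₁, hn]
  have hI : ∫ z in Q, ‖v z‖ ^ 2 ≤ 2 * (Vρ * (7 / 4 * M₂)) / w₀ := by
    rw [le_div_iff₀ hw₀0, mul_comm]
    exact hlowint.trans hlim
  have hw₀inv : w₀⁻¹ = Real.exp (μ ^ 2 * ρ ^ 2 / 4 + 1) := by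
    rw [hw₀, Real.exp_neg, inv_inv]
  have hexp : Real.exp (μ ^ 2 * ρ ^ 2 / 4 + 1) * ω =
      Real.exp 1 * (Real.exp (-(β / 4 * ρ ^ 2)) * Real.exp (-(β / 4 * ρ ^ 2))) := by
    rw [hω, ← Real.exp_add, ← Real.exp_add, ← Real.exp_add, hμ2]
    congr 1
    ring
  have hρn : ρ ^ n * Real.exp (-(β / 4 * ρ ^ 2)) ≤ n ! / (β / 4) ^ n :=
    pow_mul_exp_neg_mul_sq_le n (by positivity) hρ1
  have hAe : 0 ≤ A ^ 2 * Real.exp (-(β / 4 * ρ ^ 2)) := by positivity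
  calc ∫ z in Q, ‖v z‖ ^ 2 ≤ 2 * (Vρ * (7 / 4 * M₂)) / w₀ := hI
    _ = Real.exp 1 * (7 / 2) * Kc * V₁ * (ρ ^ n * Real.exp (-(β / 4 * ρ ^ 2))) *
          (A ^ 2 * Real.exp (-(β / 4 * ρ ^ 2))) := by
        rw [div_eq_mul_inv, hw₀inv, hVρeq, hM₂]
        calc 2 * (ρ ^ n * V₁ * (7 / 4 * (Kc * A ^ 2 * ω))) * Real.exp (μ ^ 2 * ρ ^ 2 / 4 + 1)
            = (7 / 2) * Kc * V₁ * A ^ 2 * ρ ^ n * (Real.exp (μ ^ 2 * ρ ^ 2 / 4 + 1) * ω) := by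
              ring
          _ = _ := by rw [hexp]; ring
    _ ≤ Real.exp 1 * (7 / 2) * Kc * V₁ * (n ! / (β / 4) ^ n) *
          (A ^ 2 * Real.exp (-(β / 4 * ρ ^ 2))) := by gcongr
    _ ≤ (Real.exp 1 * (7 / 2) * Kc * V₁ * (n ! / (β / 4) ^ n) + 1) *
          (A ^ 2 * Real.exp (-(β / 4 * ρ ^ 2))) :=
        mul_le_mul_of_nonneg_right (by linarith) hAe
    _ = K * A ^ 2 * Real.exp (-(β / 4 * ρ ^ 2)) := by rw [hK]; ring

end Carleman

end Literature.Analysis.FluidPDE
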